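import Literature.Probability.Percolation.ZdFiveArmSeparatedGluing
import Literature.Probability.Percolation.FourArmGarbanMonotone
import HarnessLib

/-!
# Kesten's well-separated four-arm event for critical bond percolation on `ℤ²` (definition)

Topic `Literature/Probability/Percolation`; bond percolation on `ℤ² = Site 2`
(`bondPercolation (zdGraph 2) p`). This file DEFINES the **well-separated (fenced) alternating
four-arm event** `zdFourArmSep n N` of the square annulus `A_{n,N} = {n ≤ ‖·‖_∞ ≤ N}` — four arms
in the cyclic colour order open, closed, open, closed (`σ = 1010` / `BWBW`) with PRESCRIBED,
macroscopically separated landing zones on both boundaries and Kesten's FENCES (free spaces) at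
both ends of every arm — i.e. the event `Ã̃^{I/η, I'/η'}_{4,σ}(n, N)` of P. Nolin, *Near-critical
percolation in two dimensions*, EJP 13 (2008), §4.2 (Def. 6–8 of arXiv 0711.4948) at `η = η' = 1/64`,
read for bond percolation on the square lattice (ibid. §8.1; H. Kesten, CMP 109 (1987), §2,
(2.26)–(2.28)), and the event `A_σ^{sep}(r, R)` of H. Duminil-Copin, I. Manolescu, V. Tassion,
PTRF 181 (2021), §6.2 Def. 6.1 at `q = 1`. It is the event of Kesten's arm-separation theorem

  `c · P_{1/2}(𝒜₄(A_{n,N})) ≤ P_{1/2}(zdFourArmSep n N)`  (`n₀ ≤ n`, `2n ≤ N`; `𝒜₄ = fourArmTwoClusters`),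

(Kesten 1987, Lemmas 4–5; Nolin 2008, Thm. 11 [arXiv Thm. 10]; DMT 2021, Prop. 6.2), which is
the input of the gluing half of the quasi-multiplicativity of the four-arm probability
(`DuminilCopinManolescuTassion2021_zdFourArm_quasiMult`, `ZdFourArmQuasiMult.lean`; reduced to
well-spaced radii in `ZdFourArmQuasiMultProofs.lean`) and of the printed route to Garban's (B.2)
(`FourArmGarbanFencedToSides.lean`). The separation theorem is NOT stated here (no named fact);
this file only fixes the event and proves that it is a four-arm event.

The four factors are those of the five-arm event `zdFiveArmSep` of `ZdFiveArmSeparated.lean`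
(structures `ZdSepOpenArmR/L`, `ZdSepDualArmT/B`: body, outer fence crossing + attaching walk,
inner fence crossing + attaching walk), with the pair of right arms `R⁺, R⁻` replaced by ONE
fenced open arm landing on the right sides at heights `[0, n/64]` inside and `[0, N/64]` outside
(the mirror image of the left arm):

* `zdSepOpenArmR n N` — the single fenced right arm (increasing; determined by the pairs of the
  right zone `zdSepZoneR n N`, `determinedBy_zdSepOpenArmR`);
* `zdFourArmSep n N = (zdSepOpenArmR ∩ zdSepOpenArmL) ∩ (zdSepDualArmT ∩ zdSepDualArmB)` — an
  increasing event meet a decreasing one (the shape used by the generalised FKG inequality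
  `bondPercolation_locallyMonotone_fkg`, Nolin 2008, Lemma 13);
* `mem_fourArmTwoClusters_of_mem_zdFourArmSep` — **the well-separated event is a four-arm event**:
  `zdFourArmSep n N ⊆ fourArmTwoClusters n N` on lattice configurations (`2 ≤ n ≤ N`): the two
  bodies are open crossings of `A_{n,N}` from `(±n, ·)` to `(±N, ·)`, and their inner ends are not
  joined inside the annulus because of the two closed dual arms hanging from the inner top and
  bottom sides (`not_openConnIn_sqAnnulus_of_dualArmsTB`, `SqAnnulusDualBarrier.lean`) — the
  trivial inequality `P(A_σ^{sep}) ≤ P(A_σ)` of DMT 2021, Prop. 6.2;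
* `real_zdFourArmSep_le` — hence `P_p(zdFourArmSep n N) ≤ P_p(fourArmTwoClusters n N)`.

Faithfulness: as for `zdFiveArmSep` (see the module docstring of `ZdFiveArmSeparated.lean`):
fixed landing zones of length exactly `η N`, fence boxes excluding the boundary line, bodies as
lattice walks / face walks crossing closed edges with both endpoints in the annulus. For `n < 8`
the inner fence boxes are empty and so is the event; the separation theorem concerns `n ≥ n₀`.

## References

* H. Kesten, *Scaling relations for 2D-percolation*, Comm. Math. Phys. 109 (1987) 109–156, §2,
  (2.26)–(2.28), Lemmas 4–6 [KestenScalingCMP1987].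
* P. Nolin, *Near-critical percolation in two dimensions*, EJP 13 (2008), §4.2 (arXiv 0711.4948
  Def. 6–8), §4.3 Thm. 11, Prop. 12 [arXiv Thm. 10, Prop. 11], §8.1 [Nolin2008].
* H. Duminil-Copin, I. Manolescu, V. Tassion, PTRF 181 (2021) = arXiv 2007.14707, §6.2 Def. 6.1,
  Prop. 6.2, Prop. 6.3 [DuminilCopinManolescuTassion2021].

Tree: `ZdSepOpenArmR`, `ZdSepOpenArmL`, `ZdSepDualArmT`, `ZdSepDualArmB`, `zdSepOpenArmL`,
`zdSepDualArmT`, `zdSepDualArmB`, `mem_siteSphere_of_apply_zero` (`ZdFiveArmSeparated.lean`);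
`ZdSepOpenArmR.transport`, `ZdSepOpenArmR.carrier_subset`, `zdSepZoneR`, `mem_sym2_of_forall`,
`mem_of_inter_eq` (`ZdFiveArmSeparatedGluing.lean`); `not_openConnIn_sqAnnulus_of_dualArmsTB`
(`SqAnnulusDualBarrier.lean`); `fourArmTwoClusters`, `sqAnnulus`, `siteSphere` (`FourArmGarban.lean`);
`mem_openConnIn_of_walk` (`PlanarDuality.lean`).
-/

noncomputable section

open MeasureTheory Set

namespace Literature.Probability.Percolation

open LatticeModels

/-! ### The events -/

/-- **The fenced open arm landing on the right sides**, landing heights `[0, n/64]` inside and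
`[0, N/64]` outside (mirror image of `zdSepOpenArmL`; Nolin's `Ã̃` for one open arm with its two
free spaces). [cite: Nolin2008, §4.2 (arXiv 0711.4948 Def. 6–8: free spaces, landing sequences)] -/
def zdSepOpenArmR (n N : ℕ) : Set (BondConfig (Site 2)) :=
  {ω | Nonempty (ZdSepOpenArmR ω n N 0 (n / 64 : ℕ) 0 (N / 64 : ℕ))}

/-- **Kesten's well-separated alternating four-arm event** `𝒜̃₄(A_{n,N})` for bond percolation
on `ℤ²` (Nolin's `Ã̃^{η,I/η',I'}_{4,σ}(n,N)`, `σ = BWBW`, `η = η' = 1/64`; DMT 2021's `A_{1010}^{sep}`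
at `q = 1`): fenced open arms to the right and to the left sides, fenced closed dual arms to the
top and to the bottom sides — an increasing event meet a decreasing one.
[cite: Nolin2008, §4.2 (arXiv 0711.4948 Def. 6–8, the events Ã̃)] [cite: KestenScalingCMP1987, §2 (2.26)–(2.28)]
[cite: DuminilCopinManolescuTassion2021, §6.2 Def. 6.1 (δ-well-separated arms, A_σ^sep)] -/
def zdFourArmSep (n N : ℕ) : Set (BondConfig (Site 2)) :=
  (zdSepOpenArmR n N ∩ zdSepOpenArmL n N) ∩ (zdSepDualArmT n N ∩ zdSepDualArmB n N)

/-! ### Monotonicity -/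

/-- The right arm event is increasing. [folklore] -/
theorem isUpperSet_zdSepOpenArmR (n N : ℕ) : IsUpperSet (zdSepOpenArmR n N) := by
  rintro ω ω' hle ⟨A⟩
  exact ⟨A.mono hle⟩

/-- The open part of the well-separated four-arm event is increasing. [folklore] -/
theorem isUpperSet_zdSepOpenArmR_inter_zdSepOpenArmL (n N : ℕ) :
    IsUpperSet (zdSepOpenArmR n N ∩ zdSepOpenArmL n N) :=
  (isUpperSet_zdSepOpenArmR n N).inter (isUpperSet_zdSepOpenArmL n N)

/-- Unfolding of the well-separated four-arm event. [folklore] -/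
theorem zdFourArmSep_eq (n N : ℕ) :
    zdFourArmSep n N =
      (zdSepOpenArmR n N ∩ zdSepOpenArmL n N) ∩ (zdSepDualArmT n N ∩ zdSepDualArmB n N) := rfl

/-! ### Locality of the right arm -/

/-- **The right arm event is determined by the pairs of the right zone** `zdSepZoneR n N`
(annulus, outer and inner right zones). [folklore] -/
theorem determinedBy_zdSepOpenArmR {n N : ℕ} {F : Set (Sym2 (Site 2))}
    (hF : (zdSepZoneR n N).sym2 ⊆ F) : DeterminedBy (zdSepOpenArmR n N) F := by
  suffices key : ∀ ω ω' : BondConfig (Site 2), ω ∩ F = ω' ∩ F →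
      ω ∈ zdSepOpenArmR n N → ω' ∈ zdSepOpenArmR n N by
    rw [determinedBy_iff]
    exact fun ω ω' h => ⟨key ω ω' h, key ω' ω h.symm⟩
  rintro ω ω' h ⟨A⟩
  have hA : A.carrier ⊆ zdSepZoneR n N := by
    intro v hv
    rcases A.carrier_subset (B := (n / 64 : ℕ)) (B' := (N / 64 : ℕ)) (abs_le.2 ⟨by omega, by omega⟩)
      (abs_le.2 ⟨by omega, by omega⟩) (abs_le.2 ⟨by omega, by omega⟩) (abs_le.2 ⟨by omega, by omega⟩)
      hv with h | h | h
    · exact Or.inl h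
    · exact Or.inr (Or.inl ⟨h.1, h.2.1, by have := h.2.2; push_cast at this ⊢; omega⟩)
    · exact Or.inr (Or.inr ⟨h.1, h.2.1, by have := h.2.2; push_cast at this ⊢; omega⟩)
  exact ⟨A.transport fun e he heω => mem_of_inter_eq h (hF (mem_sym2_of_forall fun x hx => hA (he x hx))) heω⟩

/-! ### The well-separated event is a four-arm event -/

/-- **`zdFourArmSep n N ⊆ fourArmTwoClusters n N` on lattice configurations** (`2 ≤ n ≤ N`): the
bodies of the two fenced open arms are open crossings of `A_{n,N}` from `x_R = (n, ·)`,
`x_L = (-n, ·)` (`|·| ≤ n/64`) to `(±N, ·)`, and `x_R`, `x_L` are not joined by an open path of the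
annulus, since the bodies of the two fenced dual arms are face walks from the faces `(c, n-1)`,
`(c', -n)` (`0 ≤ c, c' ≤ n/64`) hanging from the inner top and bottom sides to the levels `N` and
`-N-1`, crossing closed edges with both endpoints in the annulus
(`not_openConnIn_sqAnnulus_of_dualArmsTB`). This is the trivial half `φ[A_σ^{sep}] ≤ φ[A_σ]` of
DMT 2021, Prop. 6.2, in the tree's cluster form. [cite: DuminilCopinManolescuTassion2021, §6.2 Prop. 6.2 (right inequality)] [cite: KestenPTM1982, §2.2–2.3 (dual arms separate clusters)] -/
theorem mem_fourArmTwoClusters_of_mem_zdFourArmSep {n N : ℕ} (hn : 2 ≤ n) (hnN : n ≤ N)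
    {ω : BondConfig (Site 2)} (hω : ω ⊆ (zdGraph 2).edgeSet) (h : ω ∈ zdFourArmSep n N) :
    ω ∈ fourArmTwoClusters n N := by
  obtain ⟨⟨⟨A⟩, ⟨B⟩⟩, ⟨⟨T⟩, ⟨D⟩⟩⟩ := h
  have hxA := A.hx
  have hzA := A.hz
  have hxB := B.hx
  have hzB := B.hz
  have hn1 : 1 ≤ n := by omega
  have hN1 : 1 ≤ N := by omega
  have hdn : (n / 64 : ℕ) ≤ n - 2 := by omega
  have hdN : (N / 64 : ℕ) ≤ N := Nat.div_le_self N 64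
  refine ⟨A.x, mem_siteSphere_of_apply_zero hn1 (Or.inl hxA.1) (abs_le.2 ⟨by omega, by omega⟩),
    B.x, mem_siteSphere_of_apply_zero hn1 (Or.inr hxB.1) (abs_le.2 ⟨by omega, by omega⟩),
    A.z, mem_siteSphere_of_apply_zero hN1 (Or.inl hzA.1) (abs_le.2 ⟨by omega, by omega⟩),
    B.z, mem_siteSphere_of_apply_zero hN1 (Or.inr hzB.1) (abs_le.2 ⟨by omega, by omega⟩),
    mem_openConnIn_of_walk A.W A.hW A.hWo, mem_openConnIn_of_walk B.W B.hW B.hWo, ?_⟩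
  have hfT := T.hf
  have hgT := T.hg
  have hfD := D.hf
  have hgD := D.hg
  -- crossed edges of the dual bodies are closed and have both endpoints off the hole
  have hoff : ∀ {f f' : Site 2}, (∀ v ∈ sepEdge f f', v ∈ sqAnnulus n N) →
      ∀ v ∈ sepEdge f f', v ∉ box 2 (n - 1) := by
    intro f f' hv v hvm
    have := hv v hvm
    rw [sqAnnulus, Finset.mem_coe, mem_annulus] at this
    exact this.2
  exact not_openConnIn_sqAnnulus_of_dualArmsTB hn hnN hω hxA.1 (abs_le.2 ⟨by omega, by omega⟩)
    hxB.1 (abs_le.2 ⟨by omega, by omega⟩) T.Q ⟨by omega, by omega, by omega⟩ (le_of_eq hgT.1.symm)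
    (fun dq hdq => ⟨T.hQc dq hdq, hoff (T.hQa dq hdq)⟩) D.Q ⟨by omega, by omega, hfD.1⟩
    (le_of_eq hgD.1) (fun dq hdq => ⟨D.hQc dq hdq, hoff (D.hQa dq hdq)⟩)

/-- **`P_p(zdFourArmSep n N) ≤ P_p(fourArmTwoClusters n N)`** for `2 ≤ n ≤ N` and every `p`
(lattice configurations carry `P_p`). [cite: DuminilCopinManolescuTassion2021, §6.2 Prop. 6.2 (right inequality), q = 1, σ = 1010] -/
theorem real_zdFourArmSep_le (p : unitInterval) {n N : ℕ} (hn : 2 ≤ n) (hnN : n ≤ N) :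
    (bondPercolation (zdGraph 2) p).real (zdFourArmSep n N) ≤
      (bondPercolation (zdGraph 2) p).real (fourArmTwoClusters n N) := by
  refine ENNReal.toReal_mono (measure_ne_top _ _) (measure_mono_ae ?_)
  have hae : ∀ᵐ ω ∂(bondPercolation (zdGraph 2) p), ω ⊆ (zdGraph 2).edgeSet :=
    ProbabilityTheory.setBernoulli_ae_subset
  filter_upwards [hae] with ω hω h
  exact mem_fourArmTwoClusters_of_mem_zdFourArmSep hn hnN hω h

end Literature.Probability.Percolation

end
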